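import Mathlib
import Literature.InformationTheory.Coding.MaxCodeSize
import HarnessLib

/-!
# Delsarte's linear programming bound for binary codes (Krawtchouk form)

Topic `Literature/InformationTheory/Coding`. The *Delsarte–MacWilliams inequalities* and the two
versions of Delsarte's linear programming bound for the size `A(n,d)` of a binary code, exactly as
in MacWilliams–Sloane [MacWilliamsSloane1977, Ch. 5 §§3,7 and Ch. 17 §4] (originally Delsarte
[Delsarte1973]); textbook treatments also in Cameron–van Lint [CameronLint1991, (14.20)–(14.23)]
and van Lint [Vanlint1992, §5.3].

* `krawtchouk n k x = K_k(x) = Σ_{j=0}^{k} (-1)^j C(x,j) C(n-x,k-j)` — the binary Krawtchouk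
  polynomial [MacWilliamsSloane1977, Ch. 5 §7 (53) with q = 2; CameronLint1991 (14.20)], with
  `K_0 = 1`, `K_k(0) = C(n,k)` [(57)] and the generating function
  `(1 - X)^x (1 + X)^(n-x) = Σ_k K_k(x) X^k` [(54)] (`coeff_krawtchoukGen`).
* `signChar S z = χ_S(z) = ∏_{i ∈ S} (-1)^{z_i}` — the `±1` characters of `F_2^n` indexed by
  supports `S ⊆ [n]` [MacWilliamsSloane1977, Ch. 5 §3 (27): `χ_u(z^v) = (-1)^{u·v}`], and
  **Delsarte's lemma** `Σ_{|S| = k} χ_S(z) = K_k(wt z)` [Ch. 5 §3 Problem (14); CameronLint1991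
  (14.21)] (`sum_signChar_eq_krawtchouk`), with its two-point form
  `Σ_{|S| = k} χ_S(x) χ_S(y) = K_k(dist(x,y))` [Problem (12)(iv)].
* **The Delsarte–MacWilliams inequalities** [MacWilliamsSloane1977, Ch. 5 Thm. 6 `B'_k ≥ 0` and
  eq. (36) of its proof; CameronLint1991 (14.22)]: for every finite set `C` of binary words and
  every `k`,
  `Σ_{x,y ∈ C} K_k(dist(x,y)) = Σ_{|S| = k} (Σ_{x ∈ C} χ_S(x))² ≥ 0`
  (`sum_sum_krawtchouk_hammingDist_eq_sum_sq`, `sum_sum_krawtchouk_hammingDist_nonneg`), and in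
  terms of the distance distribution `B_i = #{(x,y) ∈ C² : dist = i}/|C|` [Ch. 2 §1; Ch. 5 Lemma 4,
  Thm. 5 (35)]: `Σ_{i=0}^{n} B_i K_k(i) ≥ 0` (`distCount`, `sum_distCount_mul_krawtchouk_nonneg`,
  `distDistribution`, `sum_distDistribution_mul_krawtchouk_nonneg`), together with `B_0 = 1`,
  `B_i ≥ 0`, `B_i = 0` for `0 < i < d`, `Σ_i B_i = |C|`, and the constraint form
  `Σ_{i=d}^{n} B_i K_k(i) ≥ -C(n,k)` (`neg_choose_le_sum_distDistribution_mul_krawtchouk`) — i.e.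
  the distance distribution of an `(n, M, d)` code is a feasible point of Delsarte's linear
  program (III) of value `M - 1` [MacWilliamsSloane1977, Ch. 17 §4 (23)–(26) and **Thm. 18**, the
  first version of the LP bound].
* **The second (dual) version** [MacWilliamsSloane1977, Ch. 17 §4 Problem (IV), Lemma 19,
  **Thm. 20** and **Cor. 21**; Delsarte1973]: if `β_1, …, β_n ≥ 0` and
  `β(j) := 1 + Σ_{k=1}^{n} β_k K_k(j) ≤ 0` for `d ≤ j ≤ n`, then every binary code of length `n`
  and minimum distance `≥ d` has at most `β(0) = 1 + Σ_k β_k C(n,k)` words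
  (`card_le_delsarteBound`), hence `A(n,d) ≤ β(0)` for the tree's `maxCodeSize`
  (`maxCodeSize_le_delsarteBound`). This is the CERTIFICATE form: any dual-feasible `β` is a
  checkable upper bound, "whereas only the *optimal* solution to (III) gives an upper bound"
  [loc. cit.]; it is proved here by the two-line weak-duality argument (Ch. 17 Thm. 15) written out
  on `Σ_{x,y ∈ C} β(dist(x,y))`, over any linearly ordered field (exact rational certificates);
  a worked instance (`A(3,2) ≤ 4` from `β(x) = 1 + K_1(x)`) closes the file.

Context (words only, nothing below is used): the Hamming scheme `H(n,2)` is the association scheme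
of the orbitals of the hyperoctahedral group on `{0,1}^n`; its Bose–Mesner algebra is commutative
with eigenvalues `K_k(i)` [CameronLint1991 (17.17), (17.23)], so Delsarte's LP is the
symmetry-reduced form of the Lovász–Schrijver semidefinite bound `ϑ'` for the graph `G(n,d)` of
`MaxCodeSize.lean` [Schrijver1979; McelieceEtAl1977] — the rank-`(n+1)` instance of the
regular-representation reduction of `Literature/Analysis/Convex/OrbitalRegularRepresentation.lean`.

Conventions. Binary words are `Fin n → Bool` with Mathlib's `hammingDist`, as in
`MaxCodeSize.lean`; `K_k(x)` is an integer for natural `x` (we never need non-integral `x`);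
`n - x` is natural subtraction (only `x ≤ n` occurs). Sums over `k` run over `Finset.range (n+1)`
or `Finset.Icc 1 n` as in the source.

References: [MacWilliamsSloane1977] F. J. MacWilliams, N. J. A. Sloane, *The Theory of
Error-Correcting Codes*, North-Holland 1977 — Ch. 5 §3 (Problems (12), (14), Lemma 4, Thms. 5, 6),
§7 ((53), (54), (57)); Ch. 17 §4 ((III), Thm. 18, (IV), Lemma 19, Thm. 20, Cor. 21).
[Delsarte1973] P. Delsarte, *An algebraic approach to the association schemes of coding theory*,
Philips Res. Rep. Suppl. 10 (1973). [CameronLint1991] P. J. Cameron, J. H. van Lint, *Designs,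
Graphs, Codes and their Links*, CUP 1991, (14.20)–(14.23), (17.17), (17.23). [Vanlint1992] §5.3.
[Schrijver1979] A. Schrijver, IEEE IT-25 (1979). [McelieceEtAl1977] IEEE IT-23 (1977).
-/

open Finset Polynomial

namespace Literature.InformationTheory.Coding

/-! ## 1. Binary Krawtchouk polynomials -/

/-- The binary Krawtchouk polynomial of length `n` and degree `k`, evaluated at a natural number:
`K_k(x) = Σ_{j=0}^{k} (-1)^j · C(x,j) · C(n-x,k-j)`.
[cite: MacWilliamsSloane1977, Ch. 5 §7 eq. (53) (q = 2, γ = 1); CameronLint1991 (14.20)] -/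
def krawtchouk (n k x : ℕ) : ℤ :=
  ∑ j ∈ range (k + 1), (-1) ^ j * (x.choose j : ℤ) * ((n - x).choose (k - j) : ℤ)

/-- `K_0(x) = 1`. [cite: MacWilliamsSloane1977, Ch. 5 §7 eq. (53)] -/
theorem krawtchouk_zero_left (n x : ℕ) : krawtchouk n 0 x = 1 := by
  simp [krawtchouk]

/-- `K_k(0) = C(n,k)`. [cite: MacWilliamsSloane1977, Ch. 5 §7 eq. (57) (γ = 1)] -/
theorem krawtchouk_at_zero (n k : ℕ) : krawtchouk n k 0 = n.choose k := by
  rw [krawtchouk, Finset.sum_range_succ']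
  simp [Nat.choose_zero_succ]

/-- `K_1(x) = n - 2x` (for `x ≤ n`). [cite: MacWilliamsSloane1977, Ch. 5 §7 eq. (53) (k = 1,
q = 2: `P_1(x) = γ n - q x`)] -/
theorem krawtchouk_one {n x : ℕ} (hx : x ≤ n) : krawtchouk n 1 x = (n : ℤ) - 2 * x := by
  rw [krawtchouk, Finset.sum_range_succ, Finset.sum_range_succ, Finset.sum_range_zero]
  simp only [pow_zero, Nat.choose_zero_right, Nat.cast_one, one_mul, Nat.sub_zero,
    Nat.choose_one_right, pow_one, Nat.sub_self, mul_one, zero_add, Nat.cast_sub hx]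
  ring

/-- Binomial theorem for `(1 - X)^x`: the coefficient of `X^a` is `(-1)^a C(x,a)` (private helper
for the generating function (54)). [folklore] -/
private theorem coeff_one_sub_X_pow (x a : ℕ) :
    (((1 : ℤ[X]) - X) ^ x).coeff a = (-1) ^ a * (x.choose a : ℤ) := by
  have h1 : ((1 : ℤ[X]) - X) = C (-1) * (X + C (-1)) := by
    simp only [map_neg, C_1, neg_mul, one_mul, neg_add_rev, neg_neg]
    ring
  rw [h1, mul_pow, ← C_pow, coeff_C_mul, coeff_X_add_C_pow]
  by_cases hax : a ≤ x
  · obtain ⟨b, rfl⟩ := Nat.exists_eq_add_of_le hax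
    rw [Nat.add_sub_cancel_left, pow_add]
    have hb : ((-1 : ℤ) ^ b) * (-1) ^ b = 1 := by
      rw [← pow_add, ← two_mul, pow_mul, neg_one_sq, one_pow]
    linear_combination ((-1 : ℤ) ^ a * ((a + b).choose a : ℤ)) * hb
  · rw [Nat.choose_eq_zero_of_lt (lt_of_not_ge hax)]
    simp

/-- **Generating function** of the Krawtchouk polynomials: the coefficient of `X^k` in
`(1 - X)^x (1 + X)^(n - x)` is `K_k(x)`.
[cite: MacWilliamsSloane1977, Ch. 5 §7 eq. (54) (q = 2)] -/
theorem coeff_krawtchoukGen (n k x : ℕ) :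
    (((1 : ℤ[X]) - X) ^ x * (1 + X) ^ (n - x)).coeff k = krawtchouk n k x := by
  rw [coeff_mul, Finset.Nat.sum_antidiagonal_eq_sum_range_succ_mk, krawtchouk]
  refine Finset.sum_congr rfl fun j _ => ?_
  rw [coeff_one_sub_X_pow, coeff_one_add_X_pow]

/-! ## 2. Characters of `F_2^n` and Delsarte's lemma -/

variable {n : ℕ}

/-- The sign `(-1)^b` of a bit. [cite: MacWilliamsSloane1977, Ch. 5 §3 eq. (27)] -/
def bitSign (b : Bool) : ℤ := if b then -1 else 1

/-- `bitSign b = ±1`, so its square is `1`. [cite: MacWilliamsSloane1977, Ch. 5 §3 eq. (27)] -/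
theorem bitSign_mul_self (b : Bool) : bitSign b * bitSign b = 1 := by
  cases b <;> simp [bitSign]

/-- Multiplicativity in the word: `(-1)^{a} (-1)^{b} = (-1)^{a + b}` (addition in `F_2` is `xor`,
i.e. `a != b`). [cite: MacWilliamsSloane1977, Ch. 5 §3 Problem (12)(ii),(iv)] -/
theorem bitSign_mul_bitSign (a b : Bool) : bitSign a * bitSign b = bitSign (a != b) := by
  cases a <;> cases b <;> simp [bitSign]

/-- The character of `F_2^n` attached to a support `S ⊆ [n]`, evaluated at the word `z`:
`χ_S(z) = ∏_{i ∈ S} (-1)^{z_i} = (-1)^{|S ∩ supp z|}` (`= χ_u(z^z')` of the source with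
`u = 1_S`). [cite: MacWilliamsSloane1977, Ch. 5 §3 eq. (27)] -/
def signChar (S : Finset (Fin n)) (z : Fin n → Bool) : ℤ := ∏ i ∈ S, bitSign (z i)

/-- `χ_S(x) χ_S(y) = χ_S(x + y)`, where `(x + y)_i = (x_i != y_i)`.
[cite: MacWilliamsSloane1977, Ch. 5 §3 Problem (12)(ii)] -/
theorem signChar_mul_signChar (S : Finset (Fin n)) (x y : Fin n → Bool) :
    signChar S x * signChar S y = signChar S (fun i => x i != y i) := by
  rw [signChar, signChar, signChar, ← Finset.prod_mul_distrib]
  exact Finset.prod_congr rfl fun i _ => bitSign_mul_bitSign _ _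

/-- `χ_S(x)² = 1`. [cite: MacWilliamsSloane1977, Ch. 5 §3 eq. (27)] -/
theorem signChar_mul_self (S : Finset (Fin n)) (x : Fin n → Bool) :
    signChar S x * signChar S x = 1 := by
  rw [signChar, ← Finset.prod_mul_distrib]
  exact Finset.prod_eq_one fun i _ => bitSign_mul_self _

/-- The Hamming distance of two binary words is the weight of their sum `x + y = (x_i != y_i)_i`.
[cite: MacWilliamsSloane1977, Ch. 1 §2 (dist(x,y) = wt(x - y))] -/
theorem hammingDist_eq_card_bne (x y : Fin n → Bool) :
    hammingDist x y = #{i | (x i != y i) = true} := by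
  change #{i | x i ≠ y i} = _
  exact congrArg Finset.card (Finset.filter_congr fun i _ => by simp [bne_iff_ne])

/-- **Delsarte's lemma.** For a binary word `z` of weight `w = #{i : z_i = 1}`,
`Σ_{S ⊆ [n], |S| = k} χ_S(z) = K_k(w)`: the character sum over all words of weight `k` is a
Krawtchouk value. Proof via the generating polynomial `∏_i (1 + (-1)^{z_i} X) =
(1 - X)^w (1 + X)^(n-w)`, whose `X^k`-coefficient is the left side by expanding the product over
subsets and `K_k(w)` by `coeff_krawtchoukGen`.
[cite: MacWilliamsSloane1977, Ch. 5 §3 Problem (14); CameronLint1991 Lemma (14.21)] -/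
theorem sum_signChar_eq_krawtchouk (k : ℕ) (z : Fin n → Bool) :
    ∑ S ∈ powersetCard k (univ : Finset (Fin n)), signChar S z
      = krawtchouk n k #{i | z i = true} := by
  classical
  set P : ℤ[X] := ∏ i : Fin n, (1 + C (bitSign (z i)) * X) with hP
  -- (a) expansion of the product over subsets
  have hPa : P = ∑ S ∈ (univ : Finset (Fin n)).powerset, C (signChar S z) * X ^ #S := by
    rw [hP, Finset.prod_one_add]
    refine Finset.sum_congr rfl fun S _ => ?_
    rw [Finset.prod_mul_distrib, Finset.prod_const, signChar, map_prod]
  have hcoeffa : P.coeff k = ∑ S ∈ powersetCard k (univ : Finset (Fin n)), signChar S z := by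
    rw [hPa, finsetSum_coeff, Finset.powersetCard_eq_filter, Finset.sum_filter]
    refine Finset.sum_congr rfl fun S _ => ?_
    rw [coeff_C_mul_X_pow]
    split_ifs with h1 h2 h2 <;> simp_all
  -- (b) the product splits according to the bits of `z`
  have hPb : P = ((1 : ℤ[X]) - X) ^ #{i | z i = true} * (1 + X) ^ (n - #{i | z i = true}) := by
    have hstep : P = ∏ i : Fin n, (if z i = true then ((1 : ℤ[X]) - X) else 1 + X) := by
      rw [hP]
      refine Finset.prod_congr rfl fun i _ => ?_
      cases z i
      · simp [bitSign]
      · simp only [bitSign, if_true, map_neg, C_1, neg_mul, one_mul]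
        ring
    rw [hstep, Finset.prod_ite, Finset.prod_const, Finset.prod_const]
    congr 2
    have := Finset.card_filter_add_card_filter_not (s := (univ : Finset (Fin n)))
      (fun i => z i = true)
    simp only [Finset.card_univ, Fintype.card_fin] at this
    omega
  rw [← hcoeffa, hPb, coeff_krawtchoukGen]

/-- Two-point form of Delsarte's lemma: `Σ_{|S| = k} χ_S(x) χ_S(y) = K_k(dist(x,y))`.
[cite: MacWilliamsSloane1977, Ch. 5 §3 Problems (12)(iv), (14); CameronLint1991 (14.21)] -/
theorem sum_signChar_mul_signChar_eq_krawtchouk (k : ℕ) (x y : Fin n → Bool) :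
    ∑ S ∈ powersetCard k (univ : Finset (Fin n)), signChar S x * signChar S y
      = krawtchouk n k (hammingDist x y) := by
  simp_rw [signChar_mul_signChar]
  rw [sum_signChar_eq_krawtchouk, hammingDist_eq_card_bne]

/-! ## 3. The Delsarte–MacWilliams inequalities -/

/-- **The Delsarte–MacWilliams identity.** For any finite set `C` of binary words and any `k`,
`Σ_{x ∈ C} Σ_{y ∈ C} K_k(dist(x,y)) = Σ_{|S| = k} (Σ_{x ∈ C} χ_S(x))²` — i.e.
`M² B'_k = Σ_{wt(u) = k} χ_u(C)²` in the notation of the source.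
[cite: MacWilliamsSloane1977, Ch. 5 §3 Thm. 5 eq. (35) and eq. (36) (proof of Thm. 6);
CameronLint1991 proof of (14.22)] -/
theorem sum_sum_krawtchouk_hammingDist_eq_sum_sq (C : Finset (Fin n → Bool)) (k : ℕ) :
    ∑ x ∈ C, ∑ y ∈ C, krawtchouk n k (hammingDist x y)
      = ∑ S ∈ powersetCard k (univ : Finset (Fin n)), (∑ x ∈ C, signChar S x) ^ 2 := by
  calc ∑ x ∈ C, ∑ y ∈ C, krawtchouk n k (hammingDist x y)
      = ∑ x ∈ C, ∑ y ∈ C, ∑ S ∈ powersetCard k (univ : Finset (Fin n)),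
          signChar S x * signChar S y := by
        simp_rw [sum_signChar_mul_signChar_eq_krawtchouk]
    _ = ∑ x ∈ C, ∑ S ∈ powersetCard k (univ : Finset (Fin n)), ∑ y ∈ C,
          signChar S x * signChar S y :=
        Finset.sum_congr rfl fun x _ => Finset.sum_comm
    _ = ∑ S ∈ powersetCard k (univ : Finset (Fin n)), ∑ x ∈ C, ∑ y ∈ C,
          signChar S x * signChar S y := Finset.sum_comm
    _ = ∑ S ∈ powersetCard k (univ : Finset (Fin n)), (∑ x ∈ C, signChar S x) ^ 2 := by
        refine Finset.sum_congr rfl fun S _ => ?_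
        rw [sq, Finset.sum_mul_sum]

/-- **The Delsarte–MacWilliams inequalities** (`B'_k ≥ 0`): for any finite set `C` of binary words
and any `k`, `Σ_{x,y ∈ C} K_k(dist(x,y)) ≥ 0`.
[cite: MacWilliamsSloane1977, Ch. 5 §3 Thm. 6; Delsarte1973; CameronLint1991 Lemma (14.22)] -/
theorem sum_sum_krawtchouk_hammingDist_nonneg (C : Finset (Fin n → Bool)) (k : ℕ) :
    0 ≤ ∑ x ∈ C, ∑ y ∈ C, krawtchouk n k (hammingDist x y) := by
  rw [sum_sum_krawtchouk_hammingDist_eq_sum_sq]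
  exact Finset.sum_nonneg fun S _ => sq_nonneg _

/-- The distance count `M · B_i = #{(x,y) ∈ C × C : dist(x,y) = i}` of a finite set of binary
words (`|C|` times the `i`-th entry of the distance distribution).
[cite: MacWilliamsSloane1977, Ch. 2 §1 and Ch. 5 §3 Lemma 4] -/
def distCount (C : Finset (Fin n → Bool)) (i : ℕ) : ℕ :=
  #{p ∈ C ×ˢ C | hammingDist p.1 p.2 = i}

/-- `M · B_0 = M`: the pairs at distance `0` are the diagonal pairs.
[cite: MacWilliamsSloane1977, Ch. 17 §4 (B_0 = 1)] -/
theorem distCount_zero (C : Finset (Fin n → Bool)) : distCount C 0 = #C := by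
  classical
  rw [distCount]
  have h : (C ×ˢ C).filter (fun p => hammingDist p.1 p.2 = 0) = C.map ⟨fun x => (x, x),
      fun a b h => (Prod.mk.inj h).1⟩ := by
    ext ⟨x, y⟩
    simp only [Finset.mem_filter, Finset.mem_product, hammingDist_eq_zero, Finset.mem_map,
      Function.Embedding.coeFn_mk, Prod.mk.injEq]
    constructor
    · rintro ⟨⟨hx, _⟩, rfl⟩
      exact ⟨x, hx, rfl, rfl⟩
    · rintro ⟨a, ha, rfl, rfl⟩
      exact ⟨⟨ha, ha⟩, rfl⟩
  rw [h, Finset.card_map]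

/-- `B_i = 0` for `0 < i < d` when `C` has minimum distance `≥ d`.
[cite: MacWilliamsSloane1977, Ch. 17 §4 ("B_i = 0 otherwise")] -/
theorem distCount_eq_zero_of_lt {C : Finset (Fin n → Bool)} {d : ℕ}
    (hC : (C : Set (Fin n → Bool)).Pairwise fun u v => d ≤ hammingDist u v)
    {i : ℕ} (hi0 : 0 < i) (hid : i < d) : distCount C i = 0 := by
  rw [distCount, Finset.card_eq_zero, Finset.filter_eq_empty_iff]
  intro p hp h
  rw [Finset.mem_product] at hp
  by_cases hne : p.1 = p.2
  · rw [hne, hammingDist_self] at h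
    omega
  · have := hC hp.1 hp.2 hne
    omega

/-- `B_i = 0` for `i > n` (distances never exceed the length).
[cite: MacWilliamsSloane1977, Ch. 5 §3 Lemma 4 (the distribution is indexed by 0 … n)] -/
theorem distCount_eq_zero_of_length_lt (C : Finset (Fin n → Bool)) {i : ℕ} (hi : n < i) :
    distCount C i = 0 := by
  rw [distCount, Finset.card_eq_zero, Finset.filter_eq_empty_iff]
  intro p _ h
  have := hammingDist_le_card_fintype (x := p.1) (y := p.2)
  simp only [Fintype.card_fin] at this
  omega

/-- `Σ_{i=0}^{n} M·B_i = M²`: every ordered pair of codewords is at some distance `≤ n`.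
[cite: MacWilliamsSloane1977, Ch. 17 §4 (M = 1 + Σ_j B_{τ_j})] -/
theorem sum_distCount (C : Finset (Fin n → Bool)) :
    ∑ i ∈ range (n + 1), distCount C i = #C * #C := by
  rw [← Finset.card_product]
  simp_rw [distCount]
  rw [Finset.sum_card_fiberwise_eq_card_filter]
  congr 1
  refine Finset.filter_true_of_mem fun p _ => ?_
  have := hammingDist_le_card_fintype (x := p.1) (y := p.2)
  simp only [Fintype.card_fin] at this
  exact Finset.mem_range.2 (by omega)

/-- Fibrewise form of the double sum: `Σ_{x,y ∈ C} K_k(dist(x,y)) = Σ_{i=0}^{n} (M·B_i) K_k(i)`.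
[cite: MacWilliamsSloane1977, Ch. 5 §3 Thm. 5 eq. (35)] -/
theorem sum_sum_krawtchouk_hammingDist_eq_sum_distCount (C : Finset (Fin n → Bool)) (k : ℕ) :
    ∑ x ∈ C, ∑ y ∈ C, krawtchouk n k (hammingDist x y)
      = ∑ i ∈ range (n + 1), (distCount C i : ℤ) * krawtchouk n k i := by
  classical
  rw [← Finset.sum_product' (f := fun x y => krawtchouk n k (hammingDist x y))]
  have hmaps : ∀ p ∈ C ×ˢ C, hammingDist p.1 p.2 ∈ range (n + 1) := by
    intro p _
    have := hammingDist_le_card_fintype (x := p.1) (y := p.2)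
    simp only [Fintype.card_fin] at this
    exact Finset.mem_range.2 (by omega)
  rw [← Finset.sum_fiberwise_of_maps_to hmaps]
  refine Finset.sum_congr rfl fun i _ => ?_
  rw [distCount, Finset.sum_congr rfl fun p hp => by rw [(Finset.mem_filter.1 hp).2],
    Finset.sum_const, nsmul_eq_mul]

/-- The Delsarte–MacWilliams inequalities in distance-distribution form:
`Σ_{i=0}^{n} (M·B_i) K_k(i) ≥ 0` (integer form). [cite: MacWilliamsSloane1977, Ch. 5 §3 Thm. 6
with Thm. 5 eq. (35); CameronLint1991 Lemma (14.22); Delsarte1973] -/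
theorem sum_distCount_mul_krawtchouk_nonneg (C : Finset (Fin n → Bool)) (k : ℕ) :
    0 ≤ ∑ i ∈ range (n + 1), (distCount C i : ℤ) * krawtchouk n k i := by
  rw [← sum_sum_krawtchouk_hammingDist_eq_sum_distCount]
  exact sum_sum_krawtchouk_hammingDist_nonneg C k

section Distribution

variable {𝕜 : Type*} [Field 𝕜] [LinearOrder 𝕜] [IsStrictOrderedRing 𝕜]

/-- The distance distribution `B_i = #{(x,y) ∈ C² : dist(x,y) = i} / |C|` of a finite set of
binary words, with values in a linearly ordered field ("the average number of codewords at
distance `i` from a fixed codeword"). [cite: MacWilliamsSloane1977, Ch. 2 §1; Ch. 5 §3 Lemma 4] -/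
def distDistribution (𝕜 : Type*) [Field 𝕜] (C : Finset (Fin n → Bool)) (i : ℕ) : 𝕜 :=
  (distCount C i : 𝕜) / (#C : 𝕜)

omit [LinearOrder 𝕜] [IsStrictOrderedRing 𝕜] in
/-- `B_0 = 1` for a nonempty code. [cite: MacWilliamsSloane1977, Ch. 17 §4 ("Thus B_0 = 1")] -/
theorem distDistribution_zero [CharZero 𝕜] {C : Finset (Fin n → Bool)} (hC : C.Nonempty) :
    distDistribution 𝕜 C 0 = 1 := by
  rw [distDistribution, distCount_zero]
  exact div_self (Nat.cast_ne_zero.2 (Finset.card_pos.2 hC).ne')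

omit [LinearOrder 𝕜] [IsStrictOrderedRing 𝕜] in
/-- `B_i = 0` for `0 < i < d` if `C` has minimum distance `≥ d`.
[cite: MacWilliamsSloane1977, Ch. 17 §4 ("B_i = 0 otherwise")] -/
theorem distDistribution_eq_zero_of_lt {C : Finset (Fin n → Bool)} {d : ℕ}
    (hC : (C : Set (Fin n → Bool)).Pairwise fun u v => d ≤ hammingDist u v)
    {i : ℕ} (hi0 : 0 < i) (hid : i < d) : distDistribution 𝕜 C i = 0 := by
  rw [distDistribution, distCount_eq_zero_of_lt hC hi0 hid, Nat.cast_zero, zero_div]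

/-- `B_i ≥ 0`. [cite: MacWilliamsSloane1977, Ch. 17 §4 eq. (25)] -/
theorem distDistribution_nonneg (C : Finset (Fin n → Bool)) (i : ℕ) :
    0 ≤ distDistribution 𝕜 C i :=
  div_nonneg (Nat.cast_nonneg _) (Nat.cast_nonneg _)

omit [LinearOrder 𝕜] [IsStrictOrderedRing 𝕜] in
/-- `Σ_{i=0}^{n} B_i = |C|` (the objective of Delsarte's LP (III) is `|C| - 1 = Σ_{i ≥ 1} B_i`).
[cite: MacWilliamsSloane1977, Ch. 17 §4 ("Also M = 1 + Σ_j B_{τ_j}")] -/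
theorem sum_distDistribution [CharZero 𝕜] (C : Finset (Fin n → Bool)) :
    ∑ i ∈ range (n + 1), distDistribution 𝕜 C i = #C := by
  simp_rw [distDistribution]
  rw [← Finset.sum_div, ← Nat.cast_sum, sum_distCount, Nat.cast_mul]
  by_cases h : (#C : 𝕜) = 0
  · simp [h]
  · exact mul_div_cancel_right₀ _ h

/-- **The Delsarte–MacWilliams inequalities** for the distance distribution:
`Σ_{i=0}^{n} B_i K_k(i) ≥ 0` for every `k` — the constraints (26) of Delsarte's linear program
(III), of which the distance distribution of any code is therefore a feasible solution
(the first version of the LP bound, Thm. 18, is this feasibility statement together with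
`distDistribution_zero`, `distDistribution_eq_zero_of_lt`, `distDistribution_nonneg`,
`sum_distDistribution`). [cite: MacWilliamsSloane1977, Ch. 5 §3 Thm. 6 and Ch. 17 §4
(23)–(26), Thm. 18; CameronLint1991 Lemma (14.22); Delsarte1973] -/
theorem sum_distDistribution_mul_krawtchouk_nonneg (C : Finset (Fin n → Bool)) (k : ℕ) :
    0 ≤ ∑ i ∈ range (n + 1), distDistribution 𝕜 C i * (krawtchouk n k i : 𝕜) := by
  simp_rw [distDistribution, div_mul_eq_mul_div]
  rw [← Finset.sum_div]
  refine div_nonneg ?_ (Nat.cast_nonneg _)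
  have h := sum_distCount_mul_krawtchouk_nonneg C k
  have : (0 : 𝕜) ≤ ((∑ i ∈ range (n + 1), (distCount C i : ℤ) * krawtchouk n k i : ℤ) : 𝕜) :=
    Int.cast_nonneg h
  simpa [Int.cast_sum, Int.cast_mul, Int.cast_natCast] using this

/-- Constraint (26) of Delsarte's linear program (III): for a nonempty code with minimum distance
`≥ d ≥ 1`, `Σ_{i=d}^{n} B_i K_k(i) ≥ -C(n,k)` (the `i = 0` term of the Delsarte–MacWilliams
inequality is `B_0 K_k(0) = C(n,k)` and the terms `0 < i < d` vanish).
[cite: MacWilliamsSloane1977, Ch. 17 §4 Problem (III) eq. (26), Thm. 18] -/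
theorem neg_choose_le_sum_distDistribution_mul_krawtchouk {C : Finset (Fin n → Bool)} {d : ℕ}
    (hC : (C : Set (Fin n → Bool)).Pairwise fun u v => d ≤ hammingDist u v) (hne : C.Nonempty)
    (hd : 1 ≤ d) (k : ℕ) :
    -(n.choose k : 𝕜) ≤ ∑ i ∈ Icc d n, distDistribution 𝕜 C i * (krawtchouk n k i : 𝕜) := by
  have h := sum_distDistribution_mul_krawtchouk_nonneg (𝕜 := 𝕜) C k
  have hIcc : Finset.Ico 1 (n + 1) = Finset.Icc 1 n := by
    ext i
    simp only [Finset.mem_Ico, Finset.mem_Icc]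
    omega
  rw [Finset.sum_range_eq_add_Ico _ (Nat.succ_pos n), hIcc, distDistribution_zero hne,
    krawtchouk_at_zero, one_mul, Int.cast_natCast] at h
  have hsub : Icc d n ⊆ Icc 1 n := Finset.Icc_subset_Icc_left hd
  have hzero : ∀ i ∈ Icc 1 n, i ∉ Icc d n →
      distDistribution 𝕜 C i * (krawtchouk n k i : 𝕜) = 0 := by
    intro i hi hi'
    rw [Finset.mem_Icc] at hi hi'
    rw [distDistribution_eq_zero_of_lt hC (by omega) (by omega), zero_mul]
  rw [← Finset.sum_subset hsub hzero] at h
  linarith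

/-! ## 4. The second (dual) version: Delsarte certificates -/

/-- The Delsarte polynomial `β(j) = 1 + Σ_{k=1}^{n} β_k K_k(j)` attached to dual variables
`β_1, …, β_n`. [cite: MacWilliamsSloane1977, Ch. 17 §4 Lemma 19] -/
def delsartePoly (n : ℕ) (β : ℕ → 𝕜) (j : ℕ) : 𝕜 :=
  1 + ∑ k ∈ Icc 1 n, β k * (krawtchouk n k j : 𝕜)

omit [LinearOrder 𝕜] [IsStrictOrderedRing 𝕜] in
/-- `β(0) = 1 + Σ_{k=1}^{n} β_k C(n,k)` — the value of the dual objective (36) plus one.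
[cite: MacWilliamsSloane1977, Ch. 17 §4 eq. (43)] -/
theorem delsartePoly_zero (n : ℕ) (β : ℕ → 𝕜) :
    delsartePoly n β 0 = 1 + ∑ k ∈ Icc 1 n, β k * (n.choose k : 𝕜) := by
  simp [delsartePoly, krawtchouk_at_zero]

/-- **Delsarte's linear programming bound, second version** (certificate form). Let `C` be a binary
code of length `n` whose distinct words are at Hamming distance `≥ d`, and let `β_1, …, β_n ≥ 0`
be such that `β(j) = 1 + Σ_{k=1}^{n} β_k K_k(j) ≤ 0` for all `d ≤ j ≤ n`. Then
`|C| ≤ β(0) = 1 + Σ_{k=1}^{n} β_k C(n,k)`. Proof (weak duality written out): with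
`S = Σ_{x,y ∈ C} β(dist(x,y))`, the Delsarte–MacWilliams inequalities and `β_k ≥ 0` give
`S ≥ |C|²`, while `β(dist(x,y)) ≤ 0` off the diagonal gives `S ≤ |C| β(0)`.
[cite: MacWilliamsSloane1977, Ch. 17 §4 Thm. 20 with Lemma 19 and Thm. 15; Delsarte1973] -/
theorem card_le_delsarteBound {C : Finset (Fin n → Bool)} {d : ℕ}
    (hC : (C : Set (Fin n → Bool)).Pairwise fun u v => d ≤ hammingDist u v)
    (β : ℕ → 𝕜) (hβ : ∀ k, 1 ≤ k → k ≤ n → 0 ≤ β k)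
    (hneg : ∀ j, d ≤ j → j ≤ n → delsartePoly n β j ≤ 0) :
    (#C : 𝕜) ≤ delsartePoly n β 0 := by
  classical
  have hβ0 : (1 : 𝕜) ≤ delsartePoly n β 0 := by
    rw [delsartePoly_zero]
    refine le_add_of_nonneg_right (Finset.sum_nonneg fun k hk => ?_)
    rw [Finset.mem_Icc] at hk
    exact mul_nonneg (hβ k hk.1 hk.2) (Nat.cast_nonneg _)
  rcases C.eq_empty_or_nonempty with rfl | hne
  · simp only [Finset.card_empty, Nat.cast_zero]
    exact zero_le_one.trans hβ0
  have hM : (0 : 𝕜) < #C := Nat.cast_pos.2 (Finset.card_pos.2 hne)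
  set S : 𝕜 := ∑ x ∈ C, ∑ y ∈ C, delsartePoly n β (hammingDist x y) with hS
  -- lower bound: `S ≥ M²`
  have hlow : (#C : 𝕜) * #C ≤ S := by
    have h1 : S = (∑ x ∈ C, ∑ y ∈ C, (1 : 𝕜)) +
        ∑ x ∈ C, ∑ y ∈ C, ∑ k ∈ Icc 1 n, β k * (krawtchouk n k (hammingDist x y) : 𝕜) := by
      rw [hS, ← Finset.sum_add_distrib]
      refine Finset.sum_congr rfl fun x _ => ?_
      rw [← Finset.sum_add_distrib]
      rfl
    have h2 : ∑ x ∈ C, ∑ y ∈ C, (1 : 𝕜) = (#C : 𝕜) * #C := by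
      simp only [Finset.sum_const, nsmul_eq_mul, mul_one]
    have h3 : ∑ k ∈ Icc 1 n, β k *
        ((∑ x ∈ C, ∑ y ∈ C, krawtchouk n k (hammingDist x y) : ℤ) : 𝕜)
        = ∑ x ∈ C, ∑ y ∈ C, ∑ k ∈ Icc 1 n, β k * (krawtchouk n k (hammingDist x y) : 𝕜) := by
      calc ∑ k ∈ Icc 1 n, β k * ((∑ x ∈ C, ∑ y ∈ C, krawtchouk n k (hammingDist x y) : ℤ) : 𝕜)
          = ∑ k ∈ Icc 1 n, ∑ x ∈ C, ∑ y ∈ C, β k * (krawtchouk n k (hammingDist x y) : 𝕜) := by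
            refine Finset.sum_congr rfl fun k _ => ?_
            rw [Int.cast_sum, Finset.mul_sum]
            refine Finset.sum_congr rfl fun x _ => ?_
            rw [Int.cast_sum, Finset.mul_sum]
        _ = ∑ x ∈ C, ∑ k ∈ Icc 1 n, ∑ y ∈ C, β k * (krawtchouk n k (hammingDist x y) : 𝕜) :=
            Finset.sum_comm
        _ = ∑ x ∈ C, ∑ y ∈ C, ∑ k ∈ Icc 1 n, β k * (krawtchouk n k (hammingDist x y) : 𝕜) :=
            Finset.sum_congr rfl fun x _ => Finset.sum_comm
    rw [h1, h2, ← h3]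
    refine le_add_of_nonneg_right (Finset.sum_nonneg fun k hk => ?_)
    rw [Finset.mem_Icc] at hk
    exact mul_nonneg (hβ k hk.1 hk.2)
      (Int.cast_nonneg (sum_sum_krawtchouk_hammingDist_nonneg C k))
  -- upper bound: `S ≤ M β(0)`
  have hup : S ≤ (#C : 𝕜) * delsartePoly n β 0 := by
    have hrow : ∀ x ∈ C, ∑ y ∈ C, delsartePoly n β (hammingDist x y) ≤ delsartePoly n β 0 := by
      intro x hx
      rw [← Finset.add_sum_erase C _ hx, hammingDist_self]
      refine add_le_of_nonpos_right (Finset.sum_nonpos fun y hy => ?_)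
      rw [Finset.mem_erase] at hy
      refine hneg _ (hC hx hy.2 (Ne.symm hy.1)) ?_
      have := hammingDist_le_card_fintype (x := x) (y := y)
      simpa only [Fintype.card_fin] using this
    calc S ≤ ∑ x ∈ C, delsartePoly n β 0 := Finset.sum_le_sum hrow
      _ = (#C : 𝕜) * delsartePoly n β 0 := by rw [Finset.sum_const, nsmul_eq_mul]
  exact le_of_mul_le_mul_left (hlow.trans hup) hM

/-- **Delsarte's linear programming bound for `A(n,d)`** (certificate form): if `β_1, …, β_n ≥ 0`
and `1 + Σ_{k=1}^{n} β_k K_k(j) ≤ 0` for `j = d, d+1, …, n`, then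
`A(n,d) ≤ β(0) = 1 + Σ_{k=1}^{n} β_k C(n,k)`, where `A(n,d) = maxCodeSize n d` is the tree's
code-size function (`Literature/InformationTheory/Coding/MaxCodeSize.lean`).
[cite: MacWilliamsSloane1977, Ch. 17 §4 Cor. 21; Delsarte1973] -/
theorem maxCodeSize_le_delsarteBound (n d : ℕ) (β : ℕ → 𝕜) (hβ : ∀ k, 1 ≤ k → k ≤ n → 0 ≤ β k)
    (hneg : ∀ j, d ≤ j → j ≤ n → delsartePoly n β j ≤ 0) :
    (maxCodeSize n d : 𝕜) ≤ 1 + ∑ k ∈ Icc 1 n, β k * (n.choose k : 𝕜) := by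
  obtain ⟨C, hC, hcard⟩ := exists_code_card_eq_maxCodeSize n d
  rw [← hcard, ← delsartePoly_zero]
  exact card_le_delsarteBound hC β hβ hneg

/-- Worked instance of the certificate form: the Plotkin-type certificate `β_1 = 1`,
`β_k = 0 (k ≥ 2)`, i.e. `β(x) = 1 + K_1(x) = 4 - 2x ≤ 0` for `x ≥ 2`, gives `A(3,2) ≤ β(0) = 4`
(attained by the even-weight code). [cite: MacWilliamsSloane1977, Ch. 17 §4 Cor. 21] -/
example : (maxCodeSize 3 2 : ℚ) ≤ 4 := by
  have hI : Finset.Icc 1 3 = {1, 2, 3} := by decide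
  have h := maxCodeSize_le_delsarteBound (𝕜 := ℚ) 3 2 (fun k => if k = 1 then 1 else 0)
    (fun k _ _ => by split_ifs <;> norm_num) (fun j hj hj' => by
      interval_cases j <;> norm_num [delsartePoly, hI, krawtchouk, Finset.sum_range_succ])
  refine h.trans_eq ?_
  rw [hI]
  norm_num

end Distribution

end Literature.InformationTheory.Coding
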